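import Literature.MathematicalPhysics.KineticTheory.InfiniteChainSuperstableDynamicsProofs
import Literature.MathematicalPhysics.KineticTheory.InfiniteChainSeveredGibbs
import Mathlib.MeasureTheory.Measure.HasOuterApproxClosed
import Mathlib.MeasureTheory.Constructions.Polish.StronglyMeasurable
import HarnessLib

/-!
# Superstable Gibbs states are invariant under the Buttà–Marchioro dynamics of the chain

Topic `Literature/MathematicalPhysics/KineticTheory`; companion of
`InfiniteChainSuperstableDynamics.lean` / `InfiniteChainSuperstableDynamicsProofs.lean`
(P. Buttà, C. Marchioro, *Dynamics of infinite classical anharmonic crystals*, J. Stat. Phys.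
**164** (2016) 680–692, §2 Thm 2.1 and eq. (2.6), `d = ν = 1`) and of
`InfiniteChainSeveredGibbs.lean` (O. E. Lanford, J. L. Lebowitz, E. H. Lieb, *Time evolution of
infinite anharmonic systems*, J. Stat. Phys. **16** (1977) 453–461, §4 remark (i): Gibbs states
are invariant under the severed flows `T_t^Λ`).

It supplies the step that the module docstring of `InfiniteChainSuperstableDynamics.lean` lists
under "NOT here": **invariance of a Gibbs state under the infinite-volume flow `Φ_t`**. Buttà–
Marchioro (and Buttà–Caglioti–Di Ruzza–Marchioro 2007) ASSUME time-invariant states; LLL 1977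
print invariance only for the severed flows. The route is the one named there: finite-volume
invariance (`measurePreserving_severedFlow_of_isChainGibbsMeasure`) + the partial-dynamics limit
BM (3.3) (`exists_limit_flow`: on `𝒳₀ = bmGood`, `Φ_t(x)_i = lim_n T^{Λ_{0,n}}_t(x)_i`) +
`ω(𝒳₀ᶜ) = 0` for superstable states (BM (2.6), `ButtaMarchioro2016_eq26_chain_holds`):
for a bounded continuous `g ≥ 0` on `𝒳 = (ℝ × ℝ)^ℤ` (product topology = coordinatewise
convergence), `∫ g ∘ Φ_t dμ = lim_n ∫ g ∘ T^{Λ_{0,n}}_t dμ = ∫ g dμ` by dominated convergence,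
and finite Borel measures on the Polish space `𝒳` are determined by such integrals.

## Contents (all proved; no definitions, no named facts)

* `measurePreserving_of_tendsto_ae` — an a.e. pointwise limit of measure-preserving self-maps of
  a finite Borel measure (on a space with `HasOuterApproxClosed`, e.g. metrizable) is measure
  preserving, provided it is measurable.
* `OscillatorChain.measurableSet_bmGood` — BM's good set `𝒳₀` is measurable
  (`W_{μ,k}` measurable, `𝒳₀ = ⋃_N ⋂_{μ,k} {W_{μ,k}/(2k+1) ≤ N}`).
* `OscillatorChain.measurable_limUnder_severedFlow` — the coordinatewise `limUnder` of the severed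
  flows in the boxes `Λ_{0,n}` is a (globally defined) measurable map
  (`MeasureTheory.StronglyMeasurable.limUnder`).
* `OscillatorChain.exists_bmDynamics` — **the theorem**: for even non-negative polynomial `U`, `V`
  there is an `InfiniteChainDynamics P` with carrier `𝒳₀` whose flow maps are MEASURABLE (the BM
  flow on `𝒳₀`, the identity off `𝒳₀`), with the group law, the growth bound (2.7), the
  representation as the limit of the severed flows in the boxes `Λ_{μ,n}` (any centre `μ`), and
  which PRESERVES every Gibbs state `μ` of `P` obeying the superstability estimate (2.3)
  (`D.PreservesMeasure μ`), at every temperature.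
* `OscillatorChain.preservesMeasure_of_carrier_eq_bmGood` — canonicity: ANY dynamics with carrier
  `𝒳₀` and measurable flow maps preserves every superstable Gibbs state (its flow agrees with the
  BM flow on `𝒳₀`, a set of full measure).

[cite: ButtaMarchioro2016, §2 Thm 2.1 and eq. (2.6)] [cite: LanfordLebowitzLieb1977, §4 remark (i)]
-/

noncomputable section

open MeasureTheory Filter Set
open scoped Topology BigOperators ENNReal NNReal

namespace Literature.MathematicalPhysics.KineticTheory.HeatConduction

/-! ### A.e. limits of measure-preserving maps -/

/-- **A.e. limits of measure-preserving maps are measure preserving.** Let `μ` be a finite Borel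
measure on a topological space in which indicators of closed sets are decreasing limits of
bounded continuous functions (e.g. a metrizable space), `F_n` measure-preserving self-maps and
`F` a measurable map with `F_n x → F x` for `μ`-a.e. `x`. Then `F` preserves `μ`: for bounded
continuous `f ≥ 0`, `∫ f ∘ F dμ = lim ∫ f ∘ F_n dμ = ∫ f dμ` (dominated convergence), and such
integrals determine a finite Borel measure. [folklore] -/
theorem measurePreserving_of_tendsto_ae {Ω : Type*} [MeasurableSpace Ω] [TopologicalSpace Ω]
    [HasOuterApproxClosed Ω] [BorelSpace Ω] {μ : Measure Ω} [IsFiniteMeasure μ]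
    {F : Ω → Ω} {Fs : ℕ → Ω → Ω} (hF : Measurable F) (hFs : ∀ n, MeasurePreserving (Fs n) μ μ)
    (hlim : ∀ᵐ x ∂μ, Tendsto (fun n => Fs n x) atTop (𝓝 (F x))) :
    MeasurePreserving F μ μ := by
  refine ⟨hF, ext_of_forall_lintegral_eq_of_IsFiniteMeasure fun f => ?_⟩
  have hfm : Measurable fun x => (f x : ℝ≥0∞) :=
    measurable_coe_nnreal_ennreal.comp f.continuous.measurable
  rw [lintegral_map hfm hF]
  have hconv : Tendsto (fun n => ∫⁻ x, (f (Fs n x) : ℝ≥0∞) ∂μ) atTop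
      (𝓝 (∫⁻ x, (f (F x) : ℝ≥0∞) ∂μ)) := by
    refine tendsto_lintegral_of_dominated_convergence (fun _ => ((nndist f 0 : ℝ≥0) : ℝ≥0∞))
      (fun n => hfm.comp (hFs n).measurable) (fun n => Eventually.of_forall fun x => ?_) ?_ ?_
    · exact ENNReal.coe_le_coe.2 (BoundedContinuousFunction.NNReal.upper_bound f _)
    · rw [lintegral_const]
      exact ENNReal.mul_ne_top ENNReal.coe_ne_top (measure_ne_top μ _)
    · filter_upwards [hlim] with x hx
      exact ((ENNReal.continuous_coe.comp f.continuous).tendsto (F x)).comp hx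
  have hconst : ∀ n, ∫⁻ x, (f (Fs n x) : ℝ≥0∞) ∂μ = ∫⁻ x, (f x : ℝ≥0∞) ∂μ := fun n =>
    (hFs n).lintegral_comp hfm
  exact tendsto_nhds_unique (hconv.congr hconst) tendsto_const_nhds

namespace OscillatorChain

variable {P : OscillatorChain} {s₁ s₂ : ℕ}

/-! ### Measurability of `𝒳₀` and of the limit flow -/

/-- `𝒳₀` as a countable union of countable intersections of sublevel sets of the normalised local
energies: `Q(σ) < ∞ ↔ ∃ N ∈ ℕ, ∀ μ k, k > log(e+|μ|) → W_{μ,k}(σ)/(2k+1) ≤ N`. [folklore] -/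
theorem bmGood_eq_iUnion_iInter (P : OscillatorChain) :
    P.bmGood = ⋃ N : ℕ, ⋂ μ : ℤ, ⋂ k : ℕ, {σ | Real.log (Real.exp 1 + |(μ : ℝ)|) < k →
      P.bmLocalEnergy μ k σ / (2 * (k : ℝ) + 1) ≤ N} := by
  ext σ
  simp only [bmGood, bmGrowthSet, bddAbove_def, mem_setOf_eq, mem_iUnion, mem_iInter]
  constructor
  · rintro ⟨b, hb⟩
    exact ⟨⌈b⌉₊, fun μ k hk => (hb _ ⟨μ, k, hk, rfl⟩).trans (Nat.le_ceil b)⟩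
  · rintro ⟨N, hN⟩
    refine ⟨N, ?_⟩
    rintro _ ⟨μ, k, hk, rfl⟩
    exact hN μ k hk

/-- **`𝒳₀` is measurable** when `U`, `V` are measurable. [folklore] -/
theorem measurableSet_bmGood (P : OscillatorChain) (hU : Measurable P.U) (hV : Measurable P.V) :
    MeasurableSet P.bmGood := by
  rw [bmGood_eq_iUnion_iInter]
  refine MeasurableSet.iUnion fun N => MeasurableSet.iInter fun μ =>
    MeasurableSet.iInter fun k => ?_
  by_cases hk : Real.log (Real.exp 1 + |(μ : ℝ)|) < k
  · simp only [hk, forall_true_left]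
    exact measurableSet_le ((P.measurable_bmLocalEnergy hU hV μ k).div_const _) measurable_const
  · simp only [hk, IsEmpty.forall_iff, setOf_true, MeasurableSet.univ]

/-- **The limit flow is measurable.** The coordinatewise limit (Mathlib `limUnder`, a global
definition: the genuine limit where the severed orbits converge — everywhere on `𝒳₀` by BM (3.3) —
and a junk value elsewhere) of the measurable severed flows `T^{Λ_{0,n}}_t` is a measurable
self-map of `𝒳 = (ℝ × ℝ)^ℤ` (`MeasureTheory.StronglyMeasurable.limUnder`, `ℝ × ℝ` Polish).
[folklore] -/
theorem measurable_limUnder_severedFlow (hB1 : P.CondB1) (hU : ContDiff ℝ 2 P.U)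
    (hV : ContDiff ℝ 2 P.V) (t : ℝ) :
    Measurable fun σ : ChainConfig => fun i : ℤ => limUnder atTop
      (fun n : ℕ => severedFlow hB1 (Finset.Icc ((0 : ℤ) - n) ((0 : ℤ) + n)) t σ i) := by
  refine measurable_pi_lambda _ fun i => ?_
  have h : ∀ n : ℕ, StronglyMeasurable fun σ : ChainConfig =>
      severedFlow hB1 (Finset.Icc ((0 : ℤ) - n) ((0 : ℤ) + n)) t σ i := fun n =>
    ((measurable_pi_apply i).comp (measurable_severedFlow hB1 _ hU hV t)).stronglyMeasurable
  exact (MeasureTheory.StronglyMeasurable.limUnder (l := atTop) h).measurable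

/-! ### The Buttà–Marchioro dynamics, measurably extended, preserves superstable Gibbs states -/

/-- **Buttà–Marchioro 2016, Thm 2.1 + (2.6) + LLL 1977 §4 (i): the dynamics on `𝒳₀` and the
invariance of superstable Gibbs states.** Let `U`, `V` be even non-negative polynomials of degrees
`2s₁, 2s₂ ≥ 2`. There is an infinite-volume dynamics `D` of the chain with carrier `𝒳₀ = bmGood`
such that: every `D.flow t` is measurable; `D.flow t = id` off `𝒳₀`; the group law holds on `𝒳₀`;
on `𝒳₀` the flow is the coordinatewise limit of the severed (partial) dynamics in the boxes
`Λ_{μ,n}`, for every centre `μ` (BM (3.3)); the growth bound (2.7) holds; and for every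
temperature `T` and every DLR Gibbs state `μ` of the chain at `T` obeying the superstability
estimate (2.3), `D` PRESERVES `μ` (`μ(𝒳₀ᶜ) = 0` by (2.6), and `μ ∘ (D.flow t)⁻¹ = μ` as the
dominated-convergence limit of the invariance of `μ` under the severed flows, tested on bounded
continuous functions of the Polish space `(ℝ × ℝ)^ℤ`). The invariance is not printed as a theorem
in the sources (BM assume invariant states; LLL §4 (i) is the severed-flow statement); it is the
standard passage to the limit. [cite: ButtaMarchioro2016, §2 Thm 2.1 and eq. (2.6)] -/
theorem exists_bmDynamics (hs₁ : 1 ≤ s₁) (hs₂ : 1 ≤ s₂) (hU1 : IsEvenPolyOfDegree P.U s₁)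
    (hV1 : IsEvenPolyOfDegree P.V s₂) :
    ∃ D : InfiniteChainDynamics P, D.carrier = P.bmGood ∧
      (∀ t : ℝ, Measurable (D.flow t)) ∧
      (∀ t : ℝ, ∀ σ ∉ P.bmGood, D.flow t σ = σ) ∧
      (∀ t s : ℝ, ∀ σ ∈ P.bmGood, D.flow (t + s) σ = D.flow t (D.flow s σ)) ∧
      (∀ hB1 : P.CondB1, ∀ σ ∈ P.bmGood, ∀ (t : ℝ) (μ i : ℤ),
        Tendsto (fun n : ℕ => severedFlow hB1 (Finset.Icc (μ - n) (μ + n)) t σ i) atTop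
          (𝓝 (D.flow t σ i))) ∧
      (∀ γ' : ℝ, (((max s₁ s₂ : ℕ) : ℝ) - 1) / ((max s₁ s₂ : ℕ) : ℝ) < γ' → γ' < 2 →
        ∀ β' : ℝ, 0 < β' → ∃ C : ℝ, 0 < C ∧ ∀ t : ℝ, 0 < t → ∀ σ ∈ P.bmGood,
          P.bmGrowth (D.flow t σ) ≤ C * P.bmGrowth σ *
            (1 + t ^ (2 / (2 - γ')) * (1 + t ^ β') * P.bmGrowth σ ^ (γ' / (2 - γ')))) ∧
      ∀ (T : ℝ) (μ : Measure ChainConfig), P.IsChainGibbsMeasure T μ →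
        P.HasSuperstabilityEstimate μ → D.PreservesMeasure μ := by
  classical
  have hU : ContDiff ℝ 2 P.U := hU1.contDiff_two
  have hV : ContDiff ℝ 2 P.V := hV1.contDiff_two
  have hU0 : ∀ r, 0 ≤ P.U r := hU1.choose_spec.2.2
  have hV0 : ∀ r, 0 ≤ P.V r := hV1.choose_spec.2.2
  have hB1 : P.CondB1 := condB1_of_bddBelow P hU hV
    ⟨0, by rintro _ ⟨q, rfl⟩; exact hU0 q⟩ ⟨0, by rintro _ ⟨r, rfl⟩; exact hV0 r⟩
  -- the globally defined limit flow `Ψ` (BM (3.3), centre `0`), measurable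
  let Ψ : ℝ → ChainConfig → ChainConfig := fun t σ i =>
    limUnder atTop (fun n : ℕ => severedFlow hB1 (Finset.Icc ((0 : ℤ) - n) ((0 : ℤ) + n)) t σ i)
  have hΨm : ∀ t, Measurable (Ψ t) := fun t => measurable_limUnder_severedFlow hB1 hU hV t
  obtain ⟨Φ, hΦ⟩ := exists_limit_flow hs₁ hs₂ hU1 hV1 hB1
  have hΨ : ∀ x ∈ P.bmGood, ∀ (s : ℝ) (i : ℤ),
      Tendsto (fun n : ℕ => severedFlow hB1 (Finset.Icc ((0 : ℤ) - n) ((0 : ℤ) + n)) s x i) atTop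
        (𝓝 (Ψ s x i)) := fun x hx s i => tendsto_nhds_limUnder ⟨_, hΦ x hx s i⟩
  -- BM's flow `Φ₀` (Thm 2.1, proved) and its identification with `Ψ` on `𝒳₀`
  obtain ⟨Φ₀, hmaps, -, hgrp, -, huniq, hbd⟩ :=
    ButtaMarchioro2016_thm21_chain_holds P s₁ s₂ hs₁ hs₂ hU1 hV1
  have hS1 : (1 : ℝ) ≤ ((max s₁ s₂ : ℕ) : ℝ) := by exact_mod_cast le_max_of_le_left hs₁
  have hS0 : (0 : ℝ) < ((max s₁ s₂ : ℕ) : ℝ) := by linarith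
  have hη1 : (((max s₁ s₂ : ℕ) : ℝ) - 1) / ((max s₁ s₂ : ℕ) : ℝ) ≤ 1 := by
    rw [div_le_one hS0]; linarith
  have hγ₀ : (((max s₁ s₂ : ℕ) : ℝ) - 1) / ((max s₁ s₂ : ℕ) : ℝ) <
      ((((max s₁ s₂ : ℕ) : ℝ) - 1) / ((max s₁ s₂ : ℕ) : ℝ) + 2) / 2 := by linarith
  have hγ₀2 : ((((max s₁ s₂ : ℕ) : ℝ) - 1) / ((max s₁ s₂ : ℕ) : ℝ) + 2) / 2 < 2 := by linarith
  obtain ⟨Cg, -, hgrow⟩ := growth_bound hs₁ hs₂ hU1 hV1 hB1 hΨ hγ₀ hγ₀2 one_pos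
  have hΨgood : ∀ x ∈ P.bmGood, ∀ t : ℝ, Ψ t x ∈ P.bmGood := fun x hx t =>
    (hgrow x hx |t| (abs_nonneg t) t le_rfl).1
  have hΨeq : ∀ x ∈ P.bmGood, ∀ t : ℝ, Ψ t x = Φ₀ t x := fun x hx =>
    huniq x hx (fun s => Ψ s x) (limit_flow_zero hΨ hx)
      (isSolution_limit hs₁ hs₂ hU1 hV1 hB1 hΨ hx) (hΨgood x hx)
  -- the flow: `Ψ` on `𝒳₀`, the identity off `𝒳₀` (measurable)
  have hmeasS : MeasurableSet P.bmGood :=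
    P.measurableSet_bmGood hU.continuous.measurable hV.continuous.measurable
  obtain ⟨flow, hflow_mem, hflow_nmem, hmeas⟩ : ∃ flow : ℝ → ChainConfig → ChainConfig,
      (∀ t : ℝ, ∀ σ ∈ P.bmGood, flow t σ = Ψ t σ) ∧ (∀ t : ℝ, ∀ σ ∉ P.bmGood, flow t σ = σ) ∧
        ∀ t : ℝ, Measurable (flow t) :=
    ⟨fun t => P.bmGood.piecewise (Ψ t) id, fun t σ hσ => piecewise_eq_of_mem _ _ _ hσ,
      fun t σ hσ => piecewise_eq_of_notMem _ _ _ hσ,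
      fun t => (hΨm t).piecewise hmeasS measurable_id⟩
  -- the dynamics
  refine ⟨⟨P.bmGood, flow, fun t σ hσ => ?_, fun σ hσ => ?_, fun σ hσ => ?_,
    fun γ hγg hγ t => ?_⟩, rfl, hmeas, hflow_nmem, ?_, ?_, ?_, ?_⟩
  · -- `𝒳₀` is invariant
    rw [hflow_mem t σ hσ]
    exact hΨgood σ hσ t
  · -- `Φ_0 = id` on `𝒳₀`
    rw [hflow_mem 0 σ hσ]
    exact limit_flow_zero hΨ hσ
  · -- orbits solve (2.1)
    have h : (fun t => flow t σ) = fun t => Ψ t σ := funext fun t => hflow_mem t σ hσ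
    rw [h]
    exact isSolution_limit hs₁ hs₂ hU1 hV1 hB1 hΨ hσ
  · -- uniqueness among `𝒳₀`-valued solutions
    rw [hflow_mem t _ (hγg 0), hΨeq _ (hγg 0)]
    exact huniq (γ 0) (hγg 0) γ rfl hγ hγg t
  · -- group law on `𝒳₀`
    intro t s σ hσ
    dsimp only
    rw [hflow_mem _ σ hσ, hflow_mem s σ hσ, hflow_mem t _ (hΨgood σ hσ s), hΨeq σ hσ, hΨeq σ hσ,
      hΨeq _ (hmaps s hσ)]
    exact hgrp t s σ hσ
  · -- the severed orbits in `Λ_{μ,n}` converge to the flow, for every centre `μ`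
    intro hB1' σ hσ t μ i
    dsimp only
    rw [hflow_mem t σ hσ]
    exact tendsto_severedFlow_cbox hs₁ hs₂ hU1 hV1 hB1 hΨ hσ μ t i
  · -- the growth bound (2.7)
    intro γ' hγ' hγ'2 β' hβ'
    obtain ⟨C, hC, hb⟩ := hbd γ' hγ' hγ'2 β' hβ'
    refine ⟨C, hC, fun t ht σ hσ => ?_⟩
    dsimp only
    rw [hflow_mem t σ hσ, hΨeq σ hσ]
    exact hb t ht σ hσ
  · -- invariance of superstable Gibbs states
    intro T μ hμ hSS
    haveI := hμ.isProbabilityMeasure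
    have hnull : μ (P.bmGood)ᶜ = 0 :=
      (ButtaMarchioro2016_eq26_chain_holds P s₁ s₂ hs₁ hs₂ hU1 hV1 μ hSS).2
    have hae : ∀ᵐ σ ∂μ, σ ∈ P.bmGood := by
      rw [ae_iff]
      exact hnull
    refine ⟨hae, fun t => measurePreserving_of_tendsto_ae (hmeas t)
      (fun n => measurePreserving_severedFlow_of_isChainGibbsMeasure hU hV hB1
        (Finset.Icc ((0 : ℤ) - n) ((0 : ℤ) + n)) hμ t) ?_⟩
    filter_upwards [hae] with σ hσ
    rw [hflow_mem t σ hσ]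
    exact tendsto_pi_nhds.2 fun i => hΨ σ hσ t i

/-- **Canonicity.** ANY infinite-volume dynamics of the chain with carrier `𝒳₀` and measurable flow
maps preserves every Gibbs state obeying the superstability estimate (2.3): by the `unique` field
its flow agrees on `𝒳₀` — a set of full measure, BM (2.6) — with the flow of `exists_bmDynamics`.
[cite: ButtaMarchioro2016, §2 Thm 2.1 and eq. (2.6)] -/
theorem preservesMeasure_of_carrier_eq_bmGood (hs₁ : 1 ≤ s₁) (hs₂ : 1 ≤ s₂)
    (hU1 : IsEvenPolyOfDegree P.U s₁) (hV1 : IsEvenPolyOfDegree P.V s₂)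
    (D : InfiniteChainDynamics P) (hD : D.carrier = P.bmGood) (hDm : ∀ t, Measurable (D.flow t))
    {T : ℝ} {μ : Measure ChainConfig} (hμ : P.IsChainGibbsMeasure T μ)
    (hSS : P.HasSuperstabilityEstimate μ) : D.PreservesMeasure μ := by
  obtain ⟨D₀, hD₀, -, -, -, -, -, hpres⟩ := exists_bmDynamics hs₁ hs₂ hU1 hV1
  obtain ⟨hae, hmp⟩ := hpres T μ hμ hSS
  rw [hD₀, ← hD] at hae
  refine ⟨hae, fun t => ⟨hDm t, ?_⟩⟩
  have heq : D.flow t =ᵐ[μ] D₀.flow t := by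
    filter_upwards [hae] with σ hσ
    have h := D₀.unique (fun u => D.flow u σ) (fun u => hD₀.symm ▸ hD ▸ D.flow_mem hσ u)
      (D.isSolution σ hσ) t
    simpa only [D.flow_zero σ hσ] using h
  rw [Measure.map_congr heq]
  exact (hmp t).map_eq

end OscillatorChain

end Literature.MathematicalPhysics.KineticTheory.HeatConduction

end
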